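import Literature.GroupTheory.CombinatorialGroupTheory.TreeContraction
import Mathlib.Data.Finset.Max
import HarnessLib

/-!
# Contracting a spanning tree of the covering, II: the contracted faces

Topic `Literature/GroupTheory/CombinatorialGroupTheory`; continues `TreeContraction.lean`.  The
lifted faces of the covering system with the letters of the breadth-first tree deleted
(`contractedFaces`) form a closed system with ONE vertex (`sameCycle_contracted`: the vertex
permutation is the first return of the transitive twisted permutation of
`sameCycle_contract_all`, by `sameCycle_sysPerm_filter`), and no contracted face is empty
(`contractedFace_ne_nil`: at a vertex of a face boundary farthest from the base point both
incident edges would be the tree edge of that vertex read back and forth, which a one-vertex base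
word with at least two letters never does).  ZVC 4.14.22, proof ("contract a spanning tree of
the covering complex; the Euler characteristic is unchanged").

## References

* H. Zieschang, E. Vogt, H.-D. Coldewey, *Surfaces and Planar Discontinuous Groups*, LNM 835,
  Springer 1980, 3.1.6, 4.14.22. [ZieschangVogtColdewey1980]
-/

namespace Literature.GroupTheory.CombinatorialGroupTheory

open List Equiv Equiv.Perm

namespace CoveringPresentation

universe u v

variable {X : Type u} {A : Type v} {act : FreeGroup X →* Equiv.Perm A} {a₀ : A}
  (htr : IsTransitiveFrom act a₀)

section Contract

variable [Fintype A] [DecidableEq A] [Fintype X] [DecidableEq X] {R₀ : List (X × Bool)}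
  (hR : R₀.Nodup) (hall : ∀ β : X × Bool, β ∈ R₀) (htriv : act (FreeGroup.mk R₀) = 1)
  (hV : VertexTransitive R₀)

/-! ### The contracted system -/

open Classical in
/-- The tree-letter indicator (`true` on both letters of every tree edge).
[cite: ZieschangVogtColdewey1980, 3.1.6] -/
noncomputable def isTree (l : (X × A) × Bool) : Bool := decide (IsTreeLetterOf htr (bfsOrder htr) l)

omit [Fintype X] in
/-- The tree-letter indicator is invariant under reversal. [cite: ZieschangVogtColdewey1980, 3.1.6] -/
theorem isTree_bar (l : (X × A) × Bool) : isTree htr (bar l) = isTree htr l := by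
  simp [isTree, IsTreeLetterOf, bar]

omit [Fintype X] in
/-- The product of all tree transpositions is the contraction involution of the tree letters.
[cite: ZieschangVogtColdewey1980, 3.1.6] -/
theorem treePerm_bfsOrder_eq : treePerm htr (bfsOrder htr) = delPerm (isTree htr) (isTree_bar htr) := by
  refine Equiv.ext fun l => ?_
  rw [treePerm_apply htr _ (nodup_bfsOrder htr)]
  by_cases h : IsTreeLetterOf htr (bfsOrder htr) l
  · rw [if_pos h, delPerm_apply_of_pos _ (by simpa [isTree] using h)]
  · rw [if_neg h, delPerm_apply_of_neg _ (by simpa [isTree] using h)]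

/-- **The contracted faces**: the lifted faces with all tree letters deleted.
[cite: ZieschangVogtColdewey1980, 3.1.6] -/
noncomputable def contractedFaces (R₀ : List (X × Bool)) : List (List ((X × A) × Bool)) :=
  (faces act R₀).map fun F => F.filter fun l => !isTree htr l

include hR hall htriv hV in
/-- **The contracted covering system has one vertex**: any two non-tree letters lie in one cycle
of the vertex permutation of the lifted faces with the tree letters deleted (ZVC 4.14.22,
proof: contracting a spanning tree of the covering complex). [cite: ZieschangVogtColdewey1980, 4.14.22] -/
theorem sameCycle_contracted {l l' : (X × A) × Bool} (hl : isTree htr l = false)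
    (hl' : isTree htr l' = false) : (sysPerm (contractedFaces htr R₀)).SameCycle l l' := by
  refine sameCycle_sysPerm_filter (nodup_faces_flatten act hR) (isTree htr) (isTree_bar htr) hl hl' ?_
  rw [← treePerm_bfsOrder_eq]
  exact sameCycle_contract_all htr hR hall htriv hV l l'

/-! ### No face lies inside the tree -/

omit [Fintype A] [DecidableEq A] [Fintype X] [DecidableEq X] htr in
/-- Two distinct letters over the same symbol are partners. [folklore] -/
private theorem eq_bar_of_fst_eq_of_ne {x y : (X × A) × Bool} (h1 : x.1 = y.1) (h2 : x ≠ y) :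
    x = bar y := by
  obtain ⟨i, s⟩ := x
  obtain ⟨j, t⟩ := y
  simp only at h1
  subst h1
  cases s <;> cases t
  · exact absurd rfl h2
  · rfl
  · rfl
  · exact absurd rfl h2

omit [Fintype X] [DecidableEq X] in
/-- The ends of a tree letter are a vertex and its parent: for a tree letter `l` there is a
non-base vertex `c` with `l.1 = arrow c` and `{ini l, fin l} = {c, parent c}`.
[cite: ZieschangVogtColdewey1980, 3.1.6] -/
theorem ends_of_isTree {l : (X × A) × Bool} (hl : isTree htr l = true) :
    ∃ p : NonBase a₀, l.1 = arrow htr p.2 ∧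
      ((fin act l = p.1 ∧ ini act l = parent htr p.1) ∨ (fin act l = parent htr p.1 ∧ ini act l = p.1)) := by
  obtain ⟨p, -, hp⟩ : IsTreeLetterOf htr (bfsOrder htr) l := by simpa [isTree] using hl
  refine ⟨p, hp, ?_⟩
  obtain ⟨e, s⟩ := l
  simp only at hp
  subst hp
  rcases fin_treeLetter_or htr p with ⟨h1, h2⟩ | ⟨h1, h2⟩
  · cases s
    · right; exact ⟨h2, by rw [← fin_bar]; exact h1⟩
    · left; exact ⟨h1, by rw [← fin_bar]; exact h2⟩
  · cases s
    · left; exact ⟨h2, by rw [← fin_bar]; exact h1⟩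
    · right; exact ⟨h1, by rw [← fin_bar]; exact h2⟩

omit [Fintype X] [DecidableEq X] in
/-- A tree edge with the parent at its far end is the edge of its near end: if a tree letter `l`
over `arrow p` has `dist (fin l)` maximal among `fin l`, `ini l`, then `fin l = p`.
[cite: ZieschangVogtColdewey1980, 3.1.6] -/
theorem fin_eq_of_isTree_of_le {l : (X × A) × Bool} (hl : isTree htr l = true)
    (hle : dist htr (ini act l) ≤ dist htr (fin act l)) :
    ∃ p : NonBase a₀, l.1 = arrow htr p.2 ∧ fin act l = p.1 ∧ ini act l = parent htr p.1 := by
  obtain ⟨p, hp, h | h⟩ := ends_of_isTree htr hl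
  · exact ⟨p, hp, h⟩
  · exfalso
    rw [h.1, h.2] at hle
    exact absurd (dist_parent_lt htr p.2) (not_lt.2 hle)

include hR hall htriv hV in
omit [Fintype X] in
/-- **No lifted face lies inside the tree**: every contracted face keeps a letter.  (At a
vertex of the face boundary farthest from the base point both incident edges would be the tree
edge of that vertex, traversed back and forth — but the base word, being a one-vertex word with
at least two letters, never reads an edge back and forth.) [cite: ZieschangVogtColdewey1980, 4.14.22] -/
theorem contractedFace_ne_nil (h2 : 2 ≤ R₀.length) {F : List ((X × A) × Bool)}
    (hF : F ∈ contractedFaces htr R₀) : F ≠ [] := by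
  classical
  obtain ⟨F₀, hF₀, rfl⟩ := mem_map.1 hF
  obtain ⟨b, rfl⟩ := (mem_faces act).1 hF₀
  have hR0 : R₀ ≠ [] := by rintro rfl; simp at h2
  have hF0 : liftAt act R₀ b ≠ [] := by
    rw [ne_eq, ← length_eq_zero_iff, length_liftAt]; exact length_eq_zero_iff.not.2 hR0
  have hdF : (liftAt act R₀ b).Nodup := nodup_liftAt act hR b
  intro hnil
  -- all letters of the face are tree letters
  have htree : ∀ l ∈ liftAt act R₀ b, isTree htr l = true := fun l hl => by
    by_contra h
    have : l ∈ (liftAt act R₀ b).filter fun l => !isTree htr l := mem_filter.2 ⟨hl, by simpa using h⟩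
    rw [hnil] at this; simp at this
  -- a letter whose end vertex is farthest from the base point
  obtain ⟨l₀, hl₀', hmax'⟩ := Finset.exists_max_image (liftAt act R₀ b).toFinset
    (fun l => dist htr (fin act l)) ((List.toFinset_nonempty_iff _).2 hF0)
  have hl₀ : l₀ ∈ liftAt act R₀ b := List.mem_toFinset.1 hl₀'
  have hmax : ∀ l ∈ liftAt act R₀ b, dist htr (fin act l) ≤ dist htr (fin act l₀) :=
    fun l hl => hmax' l (List.mem_toFinset.2 hl)
  -- its predecessor `m` starts at `fin l₀`
  set m := (liftAt act R₀ b).formPerm.symm l₀ with hm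
  have hml : (liftAt act R₀ b).formPerm m = l₀ := by rw [hm]; exact Equiv.apply_symm_apply _ _
  have hmF : m ∈ liftAt act R₀ b := by
    have := formPerm_mem_iff_mem (l := liftAt act R₀ b) (x := m)
    rw [hml] at this; exact this.1 hl₀
  have hfin_m : fin act l₀ = ini act m := by rw [← hml]; exact fin_formPerm_liftAt act hR hR0 htriv b hmF
  -- both `l₀` and `m` are the tree edge of `c = fin l₀`, traversed in the two directions
  have hini_l₀ : dist htr (ini act l₀) ≤ dist htr (fin act l₀) := by
    have := hmax _ (formPerm_apply_mem_of_mem hl₀)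
    rwa [fin_formPerm_liftAt act hR hR0 htriv b hl₀] at this
  obtain ⟨p, hp, hpfin, hpini⟩ := fin_eq_of_isTree_of_le htr (htree l₀ hl₀) hini_l₀
  have hfin_m' : dist htr (ini act (bar m)) ≤ dist htr (fin act (bar m)) := by
    rw [ini_bar, fin_bar, ← hfin_m]; exact hmax _ hmF
  obtain ⟨q, hq, hqfin, -⟩ := fin_eq_of_isTree_of_le htr (by rw [isTree_bar]; exact htree m hmF) hfin_m'
  rw [fin_bar, ← hfin_m, hpfin] at hqfin
  have hpq : p = q := Subtype.ext hqfin
  subst hpq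
  -- so `m = bar l₀`
  have hml₀ : m ≠ l₀ := by
    intro e
    rw [e] at hml
    have := (formPerm_apply_mem_eq_self_iff _ hdF l₀ hl₀).1 hml
    rw [length_liftAt] at this; omega
  have hbar : m = bar l₀ := by
    have hm1 : m.1 = l₀.1 := by
      change (bar m).1 = _ at hq
      rw [hp]; exact hq
    exact eq_bar_of_fst_eq_of_ne hm1 hml₀
  -- projecting to the base word: `β̄` is immediately followed by `β`, so `β̄` is a fixed point of
  -- the vertex permutation of `R₀`, contradicting `VertexTransitive R₀` with at least two letters
  have hproj : R₀.formPerm (bar (proj l₀)) = proj l₀ := by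
    rw [← proj_bar, ← hbar, ← proj_formPerm_liftAt act hR hR0 b hmF, hml]
  have hfix : vertexPerm R₀ (proj l₀) = proj l₀ := by rw [vertexPerm_apply, hproj]
  have hall2 : ∀ x ∈ R₀, x = proj l₀ := fun x hx =>
    ((hV (proj l₀) (hall _) x hx).eq_of_left hfix).symm
  obtain ⟨r₁, r₂, R', hR'⟩ : ∃ r₁ r₂ R', R₀ = r₁ :: r₂ :: R' := by
    rcases R₀ with _ | ⟨r₁, _ | ⟨r₂, R'⟩⟩
    · simp at h2
    · simp at h2
    · exact ⟨r₁, r₂, R', rfl⟩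
  have h12 : r₁ ≠ r₂ := by
    intro e; rw [hR', e] at hR; exact (nodup_cons.1 hR).1 mem_cons_self
  exact h12 ((hall2 r₁ (by rw [hR']; simp)).trans (hall2 r₂ (by rw [hR']; simp)).symm)

end Contract

end CoveringPresentation

end Literature.GroupTheory.CombinatorialGroupTheory
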